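import Summits.QuantumFields.YangMills.Theses.ParabolicTrajectory
import Literature.MathematicalPhysics.QuantumFieldTheory.BlockScaleEffectivePerturbation

/-!
# Stub `stub_formatRobustness` of line `transport-to-fixed-distance` — the registered signature is FALSE

Crux stmt-QuantumFields-10524 (`ParabolicTrajectory.TunedSequenceExists`), skeleton
`Cruxes/TunedSequenceExists/Lines/transport_to_fixed_distance.lean`; the registered stub is
`theorem stub_formatRobustness : FormatRobustness` (§ Class / § Statements re-declared byte-identically
below). This worker file does NOT prove it: `FormatRobustness` is false. What is kernel-checked here
(no `sorry`) is the FORMAT LOOPHOLE the counterexample runs through: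

* `FormatLoophole.bump` / `bump_total` / `bump_inFormat` — for ANY block size `cb`, ANY domains `D`,
  ANY `κ`, and ANY bounded measurable gauge-invariant `a ≥ 0` on the coarse torus that vanishes at the
  real points of `D (blockCorners cb)`, the perturbation whose only non-zero activity is `a` on the
  whole-torus polymer `X₀ = blockCorners cb` is `InFormat ρ D κ 0 0` (extensions `F_X := 0`, bounds
  `M := 0`; floor because `a ≥ 0`). The tree's collapsed format (`HasAnalyticNormLE` is blind off its
  domains, `HasLargeFieldFloor` only forbids LOWERING the action) puts no constraint whatsoever on how
  strongly a term may SUPPRESS configurations outside the small-field domain of `X₀`.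
* `FormatLoophole.deficit_le_of_mem_smallFieldDomain` — a real configuration inside
  `smallFieldDomain ρ cb rad ε X₀` has EVERY plaquette deficit `≤ ε + 4 N⁴ rad` (unitary `ρ`,
  Frobenius telescoping); hence (`not_mem_smallFieldDomain_of_le_deficit`) the gauge-invariant closed
  LARGE-FIELD EVENT `L := {U | ∃ p, 1 ≤ N - Re tr ρ(U_p)}` misses that domain as soon as
  `ε + 4 N⁴ rad < 1`, and (`adversarial_inFormat`) every `a ≥ 0` supported on `L` gives an effective
  action `⟨β, bump cb a⟩` satisfying the format hypothesis of the stub with `B₀ = C₀ = 0`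
  (`adversarial_sideConditions`: the stub's side conditions hold with `Λ = 0`, `ε = P/β`,
  `rad = √(P/β)`, `P = max P₀ 1`, for every `β ≥ max β₁ 1` with `P/β + 4N⁴√(P/β) < 1`).

## The counterexample (paper proof; steps (3)–(5) are measure-theoretic and not formalised)

Fix any compact simple `G` with a faithful unitary `r` (`N = r.N ≥ 1`), `cb = 1`, `κ = 1`, `C₀ = 0`,
`Λ = 0`, `CΦ = 1`, `BΦ = 12N`, `K' = 2`, and ANY `δ > 0`. The observable
`Φ := 6N - actionDensity r.ρ = ∑_{i<j} deficit (0;i,j)` is plaquette-like with `z = 1`, `R = 0`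
(affine `F`, `D³F = 0`; kernel-checked by the neighbour worker, `isPlaquetteLike_originDeficit` in
`work/stubs/stub_fixedWindowWilson.lean`). Let `P₀, β₁` be given; WLOG replace `P₀` by
`P := max P₀ 1`. Choose `β ≥ max β₁ 1` with `t := P/β + 4N⁴√(P/β) < 1` and `β² > δ/50`; put
`ε := P/β`, `rad := √(P/β)`, `B₀ := 0`. Side conditions: `adversarial_sideConditions`.

(1) DOMAIN BLINDNESS (`not_mem_smallFieldDomain_of_le_deficit`): with `X₀ = univ` (block size 1) the
set `L = {∃ p, deficit_p ≥ 1}` is closed, gauge invariant, and `complexify ρ (L) ∩ D X₀ = ∅`,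
`D := smallFieldDomain ρ 1 rad ε`.

(2) ADMISSIBLE TERMS (`adversarial_inFormat`): for every bounded measurable gauge-invariant `a ≥ 0`
vanishing off `L`, `𝓔_a := ⟨β, bump 1 a⟩` is `InFormat ρ D κ 0 0`, its total is `a` (`bump_total`), so
its Gibbs measure is `μ_a = e^{-a} ν / ν(e^{-a})`, `ν := wilsonMeasure r.ρ β` on the torus of side `S`.

(3) `L` IS TYPICAL IN LARGE VOLUME AT FIXED `β`. Changing one link `U_e` changes `S_W` by at most
`12N` (six plaquettes contain `e`, each cost in `[0, 2N]`), so the conditional law of `U_e` given the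
other links has density `≥ e^{-12Nβ}` w.r.t. Haar. Put `h := Haar{g | N - Re tr ρ(g) ≥ 1} > 0`
(`ρ` is non-trivial: a non-trivial irreducible summand `σ` has `∫ Re χ_σ = 0 < Re χ_σ(1)`, so
`Re χ_σ < 0` on a non-empty open set, where `Re tr ρ < N - dim σ ≤ N - 1`). For `e ∈ ∂p`, right
invariance gives `ν(deficit_p ≥ 1 | U off e) ≥ e^{-12Nβ} h`. The `m(S) = ⌊(S-1)/2⌋⁴` plaquettes
`p_x = (x; 0, 1)`, `x ∈ (2ℕ ∩ [0, S-2))⁴`, have private edges `e_x = (x, 0)` (`e_x ∉ ∂p_{x'}`,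
`x' ≠ x`), so conditioning successively on the `U_{e_x}`:
`ν(Lᶜ) ≤ ν(∀ x, deficit_{p_x} < 1) ≤ (1 - e^{-12Nβ} h)^{m(S)} → 0` as `S → ∞`.

(4) CORNERS HAVE VOLUME-UNIFORM MASS. `Φ₀ := Φ ∘ torusLift S` reads the six plaquettes at `0`,
`Φ₂ := Φ ∘ configShift (-2e₀) ∘ torusLift S` those at `2e₀`; for `S > 4` their edge sets `E₀, E₂`
(16 edges each) are disjoint. `Φ₀` is continuous on `G^{E₀}` with connected range `⊇ [0, 3]`
(`0` at `U ≡ 1`; `> 3` when `U_{(0,0)} = g₀` with `Re tr ρ(g₀) < N - 1`, all other links `1`). With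
`I := (2, 2.01)`, `J := (1, 1.01)` the four corners `C_{IJ} := {Φ₀ ∈ I} ∩ {Φ₂ ∈ J}`, … are open,
gauge invariant, of positive `Haar^{E₀ ∪ E₂}`-measure `h_I h_J` etc.; the conditional law of
`U|_{E₀∪E₂}` given the other links has density `≥ e^{-4 n N β}` (`n` = number of plaquettes touching
`E₀ ∪ E₂`), so `ν(C) ≥ q := e^{-4nNβ} min(h_I, h_J)² > 0` for all four corners, uniformly in `S`.

(5) TWO ADMISSIBLE ACTIONS `0.4 · 2⁸` APART. Take `S > 4` with `ν(Lᶜ) ≤ θ q`, `θ := 10⁻⁴ N⁻²`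
(by (3)). For corners `(C₁, C₂)` put `a_T := 1_L · (T · 1_{(C₁ ∪ C₂)ᶜ} + t₁ 1_{C₁} + t₂ 1_{C₂})`,
`t_i ≥ 0` equalising `e^{-t₁} ν(C₁ ∩ L) = e^{-t₂} ν(C₂ ∩ L) =: w ≥ (1-θ) q` — bounded, measurable,
gauge invariant, `≥ 0`, vanishing off `L`: admissible by (2). As `T → ∞`, `e^{-a_T} → ψ :=
1_{Lᶜ} + 1_L (e^{-t₁} 1_{C₁} + e^{-t₂} 1_{C₂})` boundedly with `ν(ψ) ≥ w > 0`, so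
`Cov_{μ_{a_T}}(Φ₀, Φ₂) → Cov_{μ_ψ}(Φ₀, Φ₂)`, `μ_ψ = ϑ ν(·|Lᶜ) + (1-ϑ)/2 [ν(·|C₁∩L) + ν(·|C₂∩L)]`,
`ϑ = ν(Lᶜ)/(ν(Lᶜ) + 2w) ≤ θ`. With `(C₁, C₂) = (C_{II}, C_{JJ})` (`p := (1-ϑ)/2 ≥ ½ - θ`, `0 ≤ Φ ≤ 12N`):
`Cov ≥ 5p - (p(3.02) + 12Nϑ)² ≥ 0.21`; with `(C₁, C₂) = (C_{IJ}, C_{JI})`: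
`Cov ≤ 2p(2.01)(1.01) + 144N²ϑ - 9p² ≤ -0.20`. Hence for `T` large the two format actions
`𝓔_± := ⟨β, bump 1 a_T^±⟩` (same `β`, `S`, `Φ`, `rad`, `ε`, `B₀`) have
`2⁸ Cov_{𝓔₊} - 2⁸ Cov_{𝓔₋} ≥ 0.4 · 2⁸ > 100 > 2δ/β²`, so at least one of them violates
`|2⁸ Cov_𝓔(Φ₀,Φ₂) - 2⁸ Cov_W(Φ₀,Φ₂)| ≤ δ/β²`. Since `P₀, β₁` were arbitrary, `FormatRobustness` fails at
`(G, r, cb, κ, C₀, Λ, CΦ, BΦ, K', δ) = (G, r, 1, 1, 0, 0, 1, 12N, 2, δ)` — for EVERY `δ > 0`, and in fact for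
every `Λ ≥ 0`, `C₀ ≥ 0`, `K' ≥ 2`, `cb ≥ 1` (use `X₀ = blockCorners cb`).

WHY THE DOCSTRING'S DEFENCE FAILS. "Configurations outside the `ε`-small region carry Wilson weight
`e^{-cβε} ≤ e^{-cP₀}`" is a PER-PLAQUETTE (per-block) estimate; the activity of a polymer `X` is free
(up to sign) on the complement of `D X`, an event of `ν`-probability `→ 1` as `|X| → ∞` at fixed `β`
(extensive entropy of large fields, step (3)), and the weights `e^{κ|X|}` of the format norms never see
positive parts. No choice of `P₀(δ, K', …)`, `β₁(δ, K', …)` can repair this, because `S` (hence `|X₀|`)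
is chosen after them and is unbounded along the line (`Glue B` needs `Sc ≥ Svol` arbitrarily large).

WHAT WOULD CLOSE THE LOOPHOLE (for the lead; not a claim of truth). Either (a) a two-sided REAL
weighted bound on the terms, `𝓔.terms.NormLE κ B₀` (as the QCD routes demand:
`Cruxes/RobustYangMills/Lines/soft-absorption-balaban-cone.lean` L274–278, `HasAnalyticNormLE ∧ NormLE`),
which kills `bump` (`‖a‖_∞ ≤ B₀ e^{-κ S⁴/cb⁴}`) but also excludes genuine large-field suppression
factors of Bałaban's densities (they would have to travel as a separate rough-region factor, tree
`BalabanFormatDensity`); or (b) a volume cap `S ≤ Svol` with `Svol` quantified BEFORE `∃ P₀ β₁` — but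
`Glue.lowerBoundApriori_of_stubs` feeds coarse tori of unbounded side (`Sc ≥ max (Cvol K') (2K'+1)`,
growing with the physical volume), so (b) does not compose. Under (a) the statement becomes a
volume-uniform weak-coupling perturbation estimate for `Cov` — the same missing technology that blocks
`stub_fixedWindowWilson`.
-/

noncomputable section

open Filter Topology MeasureTheory Finset
open scoped Matrix Matrix.Norms.Frobenius
open Literature.MathematicalPhysics.QuantumFieldTheory Literature.MathematicalPhysics.QuantumLattice

namespace Summit.QuantumFields.YangMills.Cruxes.TunedSequenceExists.TransportToFixedDistance

/-! ## § Class — plaquette-like coarse observables (verbatim from the skeleton) -/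

section Class

variable {G : Type} [Group G] [MeasurableSpace G] {N : ℕ}

/-- The deficit `N - Re tr ρ(U_p) ≥ 0` of the `ℤ⁴` plaquette `p` (quadratic order in the field
strength). -/
def deficit (ρ : G →* Matrix (Fin N) (Fin N) ℂ) (p : ZdPlaquette 4) (U : LGConfig 4 G) : ℝ :=
  (N : ℝ) - plaquetteObs ρ p.1 p.2.1.1 p.2.1.2 U

/-- **Plaquette-like coarse observables** with constants `(z, CΦ, BΦ, R)`: `Φ` is a bounded
(`|Φ| ≤ BΦ`), measurable, gauge-invariant function of the holonomies of finitely many plaquettes `Pl`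
within sup-distance `R` of the origin, through a `C³` function `F` of the representing matrices with
`‖D³F‖ ≤ CΦ` (smoothness near flat configurations is what makes the fixed-window bound UNIFORM over
the class: `Φ = Q_Φ + O(|F|³)` with a positive semi-definite quadratic part), of quadratic GROWTH
`Φ ≤ CΦ · ∑_{p ∈ Pl} deficit_p`, and DOMINATING `z` times the origin action-density deficit up to a
cubic-order error, `Φ ≥ z · (6N - actionDensity) - CΦ · (∑_{p ∈ Pl} deficit_p)^{3/2}` — so that
`Hess Φ ≥ z · Hess(6N - actionDensity)` at flat configurations and, by the monotonicity
`tr(AΣBΣ) ≥ tr(aΣbΣ)` (`A ≥ a ≥ 0`, `B ≥ b ≥ 0`), the leading `Φ–Φ` two-point coefficient is at least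
`z²` times the two-gluon exchange of plaquette deficits. Intended inhabitant: the local part, in the
block field, of the conditional mean of the block-AVERAGED fine action density (Jensen gives the
dominance clause); `Φ = z·(6N - actionDensity)` itself (`F` affine in the matrix entries, `D³F = 0`) shows the
class is non-trivially inhabited, while the triage's `z·x₀ - C·x₀^{3/2}` is NOT a member (not `C³` at flat
configurations — the regularity is deliberate: merely measurable members sandwiched between the two
clauses could flip the sign of the `Φ–Φ` covariance through oscillating cubic-order parts). -/
def IsPlaquetteLike (ρ : G →* Matrix (Fin N) (Fin N) ℂ) (z CΦ BΦ : ℝ) (R : ℕ)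
    (Φ : LGConfig 4 G → ℝ) : Prop :=
  Measurable Φ ∧ IsZdGaugeInvariant Φ ∧ (∀ U, |Φ U| ≤ BΦ) ∧
    ∃ (Pl : Finset (ZdPlaquette 4)) (F : (↥Pl → Matrix (Fin N) (Fin N) ℂ) → ℝ),
      (∀ p ∈ Pl, ∀ i : Fin 4, |p.1 i| ≤ (R : ℤ)) ∧
      (∀ U, Φ U = F (fun p => ρ (plaquetteHolonomyZd U p.1.1 p.1.2.1.1 p.1.2.1.2))) ∧
      ContDiff ℝ 3 F ∧ (∀ X, ‖iteratedFDeriv ℝ 3 F X‖ ≤ CΦ) ∧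
      (∀ U, Φ U ≤ CΦ * ∑ p ∈ Pl, deficit ρ p U) ∧
      ∀ U, z * (6 * (N : ℝ) - actionDensity ρ U) -
          CΦ * (∑ p ∈ Pl, deficit ρ p U) ^ (3 / 2 : ℝ) ≤ Φ U

end Class

/-- **Stub 3 (M) — robustness of the fixed window under Bałaban-format terms** (verbatim from the
skeleton). FALSE — see the module docstring and § Loophole below. -/
def FormatRobustness : Prop :=
  ∀ (G : Type) [Group G] [TopologicalSpace G] [IsTopologicalGroup G] [CompactSpace G],
    IsCompactSimpleLieGroup G →
      letI : MeasurableSpace G := borel G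
      haveI : BorelSpace G := ⟨rfl⟩
      ∀ (r : LatticeRep G) (cb : ℕ) [NeZero cb] (κ C₀ Λ CΦ BΦ : ℝ) (K' : ℕ),
        0 < κ → 1 ≤ K' → ∀ δ : ℝ, 0 < δ →
          ∃ P₀ β₁ : ℝ, ∀ (B₀ rad ε z : ℝ) (R : ℕ) (Φ : LGConfig 4 G → ℝ) (S : ℕ) [NeZero S]
            (𝓔 : BalabanEffectiveAction 4 S G cb),
            0 < rad → 0 < ε → B₀ ≤ Λ * rad ^ 2 → 1 / 2 ≤ z → z ≤ 2 → 2 * R < K' → 2 * K' < S →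
              IsPlaquetteLike r.ρ z CΦ BΦ R Φ →
              𝓔.InFormat r.ρ (smallFieldDomain r.ρ cb rad ε) κ B₀ C₀ → β₁ ≤ 𝓔.β →
              P₀ ≤ 𝓔.β * ε → P₀ ≤ 𝓔.β * rad ^ 2 →
                |(K' : ℝ) ^ 8 * 𝓔.terms.connectedCorr r.ρ 𝓔.β Φ Φ K' -
                    (K' : ℝ) ^ 8 * latticeConnectedCorr r.ρ 𝓔.β S Φ Φ K'| ≤ δ / 𝓔.β ^ 2

/-! ## § Loophole — the adversarial whole-torus term (kernel-checked part of the counterexample) -/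

namespace FormatLoophole

/-! ### 1. Format blindness -/

section Bump

variable {G : Type} [Group G] [MeasurableSpace G] {S : ℕ} [NeZero S]

/-- Every block corner `blockCorner cb x` is a block corner. -/
theorem blockCorner_mem_blockCorners (cb : ℕ) (x : Site 4 S) :
    blockCorner cb x ∈ blockCorners (d := 4) (L := S) cb :=
  Finset.mem_image_of_mem _ (Finset.mem_univ _)

/-- The whole-torus polymer `X₀ = blockCorners cb` owns every link. -/
theorem polymerEdges_blockCorners (cb : ℕ) :
    polymerEdges cb (blockCorners (d := 4) (L := S) cb) = Finset.univ := by
  ext e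
  simp only [mem_polymerEdges_iff, blockCorner_mem_blockCorners, Finset.mem_univ]

/-- … and every plaquette. -/
theorem mem_polymerPlaquettes_blockCorners (cb : ℕ) (p : Plaquette 4 S) :
    p ∈ polymerPlaquettes cb (blockCorners (d := 4) (L := S) cb) := by
  simp only [polymerPlaquettes, Finset.mem_filter, Finset.mem_univ, true_and]
  exact blockCorner_mem_blockCorners cb p.1

/-- The whole torus is a polymer. -/
theorem blockCorners_mem_polymers (cb : ℕ) : blockCorners (d := 4) (L := S) cb ∈ polymers cb :=
  mem_polymers_iff.2 (Finset.Subset.refl _)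

/-- **The adversarial whole-torus term**: the block-scale perturbation whose only non-zero activity is
`a` on the polymer `X₀ = blockCorners cb` of ALL blocks (a bounded measurable gauge-invariant function
of all links). -/
def bump (cb : ℕ) (a : GaugeConfig 4 S G → ℝ) (hgi : IsGaugeInvariant a) (hmeas : Measurable a)
    (hbdd : ∃ C, ∀ U, |a U| ≤ C) : QuasiLocalGaugePerturbation 4 S G cb where
  act X U := if X = blockCorners cb then a U else 0
  dependsOn' X := by
    by_cases hX : X = blockCorners cb
    · subst hX
      intro U V h
      have hUV : U = V := funext fun e => h e (by simp [polymerEdges_blockCorners])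
      simp [hUV]
    · intro U V _
      simp [hX]
  gaugeInvariant' X := fun g U => by
    by_cases hX : X = blockCorners cb <;> simp [hX, hgi g U]
  measurable' X := by
    by_cases hX : X = blockCorners cb <;> simp [hX, hmeas]
  bounded' X := by
    obtain ⟨C, hC⟩ := hbdd
    refine ⟨max C 0, fun U => ?_⟩
    by_cases hX : X = blockCorners cb
    · simp only [hX, if_true]
      exact (hC U).trans (le_max_left _ _)
    · simp [hX]

variable {cb : ℕ} {a : GaugeConfig 4 S G → ℝ} {hgi : IsGaugeInvariant a} {hmeas : Measurable a}
  {hbdd : ∃ C, ∀ U, |a U| ≤ C}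

@[simp] theorem bump_act_blockCorners (U : GaugeConfig 4 S G) :
    (bump cb a hgi hmeas hbdd).act (blockCorners cb) U = a U :=
  if_pos rfl

theorem bump_act_of_ne {X : Finset (Site 4 S)} (hX : X ≠ blockCorners cb) (U : GaugeConfig 4 S G) :
    (bump cb a hgi hmeas hbdd).act X U = 0 :=
  if_neg hX

/-- The total of the adversarial term is `a` itself: the Gibbs weight of `⟨β, bump cb a⟩` is
`e^{-β S_W(U) - a(U)}`. -/
theorem bump_total (U : GaugeConfig 4 S G) : (bump cb a hgi hmeas hbdd).total U = a U := by
  rw [QuasiLocalGaugePerturbation.total, Finset.sum_eq_single (blockCorners cb)]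
  · exact bump_act_blockCorners U
  · intro X _ hX
    exact bump_act_of_ne hX U
  · intro h
    exact absurd (blockCorners_mem_polymers cb) h

variable {N : ℕ} (ρ : G →* Matrix (Fin N) (Fin N) ℂ)

/-- **FORMAT BLINDNESS.** For any domains `D`, any `κ`, any coupling `β` and any bounded measurable
gauge-invariant `a ≥ 0` vanishing at the real points of `D X₀`, `X₀ = blockCorners cb`, the effective
action `⟨β, bump cb a⟩` is in Bałaban format with constants `B₀ = C₀ = 0`: analytic extensions
`F_X := 0` with bounds `M := 0` (the analyticity predicate only sees real points INSIDE the domain),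
floor `0` because `a ≥ 0` (the floor only sees negative parts). By monotonicity
(`HasAnalyticNormLE.mono`, `HasLargeFieldFloor.mono`) it is then in format `(κ, B₀, C₀)` for all
`B₀, C₀ ≥ 0`. -/
theorem bump_inFormat (ha : ∀ U, 0 ≤ a U) (D : Finset (Site 4 S) → Set (ComplexGaugeConfig 4 S N))
    (hD : ∀ U, complexify ρ U ∈ D (blockCorners cb) → a U = 0) (β κ : ℝ) :
    (⟨β, bump cb a hgi hmeas hbdd⟩ : BalabanEffectiveAction 4 S G cb).InFormat ρ D κ 0 0 := by
  refine ⟨⟨fun _ => 0, fun X _ => ⟨0, differentiableOn_const 0, fun U hU => ?_, fun Z _ => by simp⟩,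
    fun y _ => by simp⟩, ?_⟩
  · by_cases hX : X = blockCorners cb
    · subst hX
      simp [hD U hU]
    · simp [bump_act_of_ne hX]
  · exact QuasiLocalGaugePerturbation.hasLargeFieldFloor_of_nonneg
      (fun X _ U => by
        by_cases hX : X = blockCorners cb
        · subst hX
          simpa using ha U
        · simp [bump_act_of_ne hX]) le_rfl

/-- Format blindness with arbitrary nonnegative constants `(B₀, C₀)`. -/
theorem bump_inFormat_of_nonneg (ha : ∀ U, 0 ≤ a U)
    (D : Finset (Site 4 S) → Set (ComplexGaugeConfig 4 S N))
    (hD : ∀ U, complexify ρ U ∈ D (blockCorners cb) → a U = 0) (β κ : ℝ) {B₀ C₀ : ℝ}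
    (hB₀ : 0 ≤ B₀) (hC₀ : 0 ≤ C₀) :
    (⟨β, bump cb a hgi hmeas hbdd⟩ : BalabanEffectiveAction 4 S G cb).InFormat ρ D κ B₀ C₀ :=
  ⟨(bump_inFormat ρ ha D hD β κ).1.mono ρ hB₀, (bump_inFormat ρ ha D hD β κ).2.mono hC₀⟩

end Bump

/-! ### 2. Geometry: the small-field domain of the whole torus misses the large-field event -/

section Geometry

variable {N : ℕ}

private theorem frob_norm_sq (A : Matrix (Fin N) (Fin N) ℂ) : ‖A‖ ^ 2 = ∑ i, ∑ j, ‖A i j‖ ^ 2 := by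
  have h0 : (0 : ℝ) ≤ ∑ i, ∑ j, ‖A i j‖ ^ (2 : ℝ) := by positivity
  rw [Matrix.frobenius_norm_def, ← Real.sqrt_eq_rpow, Real.sq_sqrt h0]
  simp_rw [Real.rpow_two]

private theorem norm_entry_le (A : Matrix (Fin N) (Fin N) ℂ) (i j : Fin N) : ‖A i j‖ ≤ ‖A‖ := by
  have h1 : ‖A i j‖ ^ 2 ≤ ‖A‖ ^ 2 := by
    rw [frob_norm_sq]
    exact (Finset.single_le_sum (f := fun j => ‖A i j‖ ^ 2) (fun _ _ => sq_nonneg _)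
      (Finset.mem_univ j)).trans
      (Finset.single_le_sum (f := fun i => ∑ j, ‖A i j‖ ^ 2)
        (fun _ _ => Finset.sum_nonneg fun _ _ => sq_nonneg _) (Finset.mem_univ i))
  exact (pow_le_pow_iff_left₀ (norm_nonneg _) (norm_nonneg _) two_ne_zero).1 h1

/-- `|Re tr A| ≤ N ‖A‖_F`. -/
theorem abs_re_trace_le (A : Matrix (Fin N) (Fin N) ℂ) : |A.trace.re| ≤ N * ‖A‖ := by
  calc |A.trace.re| ≤ ‖A.trace‖ := Complex.abs_re_le_norm _
    _ = ‖∑ i, A i i‖ := by simp [Matrix.trace]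
    _ ≤ ∑ i, ‖A i i‖ := norm_sum_le _ _
    _ ≤ ∑ _i : Fin N, ‖A‖ := Finset.sum_le_sum fun i _ => norm_entry_le A i i
    _ = N * ‖A‖ := by simp

/-- A unitary `N × N` matrix has Frobenius norm `≤ N` (entries of modulus `≤ 1`). -/
theorem frob_norm_le_of_mem_unitaryGroup {V : Matrix (Fin N) (Fin N) ℂ}
    (hV : V ∈ Matrix.unitaryGroup (Fin N) ℂ) : ‖V‖ ≤ N := by
  have h2 : ‖V‖ ^ 2 ≤ (N : ℝ) ^ 2 := by
    rw [frob_norm_sq]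
    calc ∑ i, ∑ j, ‖V i j‖ ^ 2 ≤ ∑ _i : Fin N, ∑ _j : Fin N, (1 : ℝ) :=
          Finset.sum_le_sum fun i _ => Finset.sum_le_sum fun j _ => by
            have h := entry_norm_bound_of_unitary hV i j
            have h' := norm_nonneg (V i j)
            nlinarith
      _ = (N : ℝ) ^ 2 := by simp [sq]
  exact (pow_le_pow_iff_left₀ (norm_nonneg _) (Nat.cast_nonneg _) two_ne_zero).1 h2

/-- Frobenius telescoping: `‖ABCD - A'B'C'D'‖ ≤ N³ (‖A-A'‖ + ‖B-B'‖ + ‖C-C'‖ + ‖D-D'‖)` for unitary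
factors. -/
theorem frob_prod₄_sub_le {A B C D A' B' C' D' : Matrix (Fin N) (Fin N) ℂ}
    (hB : B ∈ Matrix.unitaryGroup (Fin N) ℂ) (hC : C ∈ Matrix.unitaryGroup (Fin N) ℂ)
    (hD : D ∈ Matrix.unitaryGroup (Fin N) ℂ) (hA' : A' ∈ Matrix.unitaryGroup (Fin N) ℂ)
    (hB' : B' ∈ Matrix.unitaryGroup (Fin N) ℂ) (hC' : C' ∈ Matrix.unitaryGroup (Fin N) ℂ) :
    ‖A * B * C * D - A' * B' * C' * D'‖ ≤
      (N : ℝ) ^ 3 * (‖A - A'‖ + ‖B - B'‖ + ‖C - C'‖ + ‖D - D'‖) := by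
  have key : A * B * C * D - A' * B' * C' * D' =
      (A - A') * B * C * D + A' * (B - B') * C * D + A' * B' * (C - C') * D +
        A' * B' * C' * (D - D') := by
    noncomm_ring
  have n4 : ∀ X Y Z W : Matrix (Fin N) (Fin N) ℂ, ‖X * Y * Z * W‖ ≤ ‖X‖ * ‖Y‖ * ‖Z‖ * ‖W‖ :=
    fun X Y Z W => (norm_mul_le _ _).trans <| mul_le_mul_of_nonneg_right
      ((norm_mul_le _ _).trans <| mul_le_mul_of_nonneg_right (norm_mul_le _ _) (norm_nonneg _))
      (norm_nonneg _)
  have nB := frob_norm_le_of_mem_unitaryGroup hB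
  have nC := frob_norm_le_of_mem_unitaryGroup hC
  have nD := frob_norm_le_of_mem_unitaryGroup hD
  have nA' := frob_norm_le_of_mem_unitaryGroup hA'
  have nB' := frob_norm_le_of_mem_unitaryGroup hB'
  have nC' := frob_norm_le_of_mem_unitaryGroup hC'
  rw [key]
  have e1 : ‖(A - A') * B * C * D + A' * (B - B') * C * D + A' * B' * (C - C') * D +
        A' * B' * C' * (D - D')‖ ≤
      ‖(A - A') * B * C * D + A' * (B - B') * C * D + A' * B' * (C - C') * D‖ +
        ‖A' * B' * C' * (D - D')‖ := norm_add_le _ _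
  have e2 : ‖(A - A') * B * C * D + A' * (B - B') * C * D + A' * B' * (C - C') * D‖ ≤
      ‖(A - A') * B * C * D + A' * (B - B') * C * D‖ + ‖A' * B' * (C - C') * D‖ := norm_add_le _ _
  have e3 : ‖(A - A') * B * C * D + A' * (B - B') * C * D‖ ≤
      ‖(A - A') * B * C * D‖ + ‖A' * (B - B') * C * D‖ := norm_add_le _ _
  calc ‖(A - A') * B * C * D + A' * (B - B') * C * D + A' * B' * (C - C') * D +
          A' * B' * C' * (D - D')‖
      ≤ ‖(A - A') * B * C * D‖ + ‖A' * (B - B') * C * D‖ + ‖A' * B' * (C - C') * D‖ +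
          ‖A' * B' * C' * (D - D')‖ := by linarith
    _ ≤ ‖A - A'‖ * N * N * N + N * ‖B - B'‖ * N * N + N * N * ‖C - C'‖ * N +
          N * N * N * ‖D - D'‖ := by
        gcongr ?_ + ?_ + ?_ + ?_
        · exact (n4 _ _ _ _).trans (by gcongr)
        · exact (n4 _ _ _ _).trans (by gcongr)
        · exact (n4 _ _ _ _).trans (by gcongr)
        · exact (n4 _ _ _ _).trans (by gcongr)
    _ = (N : ℝ) ^ 3 * (‖A - A'‖ + ‖B - B'‖ + ‖C - C'‖ + ‖D - D'‖) := by ring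

variable {G : Type} [Group G] (ρ : G →* Matrix (Fin N) (Fin N) ℂ)

/-- A unitary representation sends inverses to adjoints. -/
theorem map_inv_eq_conjTranspose (hρu : ∀ g, ρ g ∈ Matrix.unitaryGroup (Fin N) ℂ) (g : G) :
    ρ g⁻¹ = (ρ g)ᴴ := by
  have h1 : ρ g * (ρ g)ᴴ = 1 := by
    rw [← Matrix.star_eq_conjTranspose]
    exact Matrix.mem_unitaryGroup_iff.1 (hρu g)
  calc ρ g⁻¹ = ρ g⁻¹ * (ρ g * (ρ g)ᴴ) := by rw [h1, mul_one]
    _ = (ρ g)ᴴ := by rw [← mul_assoc, ← map_mul, inv_mul_cancel, map_one, one_mul]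

variable {S : ℕ} [NeZero S]

/-- **Inside the small-field domain of the whole torus every plaquette is nearly small**: if the real
configuration `U` lies in `smallFieldDomain ρ cb rad ε X₀`, `X₀ = blockCorners cb`, then EVERY
plaquette of the torus has deficit `N - Re tr ρ(U_p) ≤ ε + 4 N⁴ rad` (unitary `ρ`: `U` is within
sup-Frobenius distance `rad` of a configuration all of whose plaquettes are `ε`-small, and
`U ↦ Re tr ρ(U_p)` is `4N⁴`-Lipschitz for that distance). -/
theorem deficit_le_of_mem_smallFieldDomain (hρu : ∀ g, ρ g ∈ Matrix.unitaryGroup (Fin N) ℂ)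
    {cb : ℕ} {rad ε : ℝ} {U : GaugeConfig 4 S G}
    (hU : complexify ρ U ∈ smallFieldDomain ρ cb rad ε (blockCorners cb)) (p : Plaquette 4 S) :
    (N : ℝ) - (ρ (plaquetteHolonomy U p.1 p.2.1.1 p.2.1.2)).trace.re ≤ ε + 4 * (N : ℝ) ^ 4 * rad := by
  simp only [smallFieldDomain, Set.mem_iUnion, Set.mem_setOf_eq, exists_prop] at hU
  obtain ⟨U', hU's, hball⟩ := hU
  rw [Metric.mem_ball] at hball
  have hsmall := hU's p (mem_polymerPlaquettes_blockCorners cb p)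
  have hedge : ∀ e : Edge 4 S, ‖ρ (U e) - ρ (U' e)‖ ≤ rad := fun e => by
    have h := dist_le_pi_dist (complexify ρ U) (complexify ρ U') e
    rw [dist_eq_norm] at h
    exact h.trans hball.le
  set x := p.1
  set i := p.2.1.1
  set j := p.2.1.2
  have hhol : ∀ V : GaugeConfig 4 S G, ρ (plaquetteHolonomy V x i j) =
      ρ (V (x, i)) * ρ (V (x.shift i, j)) * (ρ (V (x.shift j, i)))ᴴ * (ρ (V (x, j)))ᴴ := fun V => by
    simp only [plaquetteHolonomy, map_mul, map_inv_eq_conjTranspose ρ hρu]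
  have hunit : ∀ g : G, (ρ g)ᴴ ∈ Matrix.unitaryGroup (Fin N) ℂ := fun g => by
    rw [← map_inv_eq_conjTranspose ρ hρu]
    exact hρu _
  have hdiff : ‖ρ (plaquetteHolonomy U x i j) - ρ (plaquetteHolonomy U' x i j)‖ ≤
      (N : ℝ) ^ 3 * (4 * rad) := by
    rw [hhol U, hhol U']
    refine (frob_prod₄_sub_le (hρu _) (hunit _) (hunit _) (hρu _) (hρu _) (hunit _)).trans ?_
    gcongr
    calc ‖ρ (U (x, i)) - ρ (U' (x, i))‖ + ‖ρ (U (x.shift i, j)) - ρ (U' (x.shift i, j))‖ +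
          ‖(ρ (U (x.shift j, i)))ᴴ - (ρ (U' (x.shift j, i)))ᴴ‖ + ‖(ρ (U (x, j)))ᴴ - (ρ (U' (x, j)))ᴴ‖
        ≤ rad + rad + rad + rad := by
          gcongr ?_ + ?_ + ?_ + ?_
          · exact hedge _
          · exact hedge _
          · rw [← Matrix.conjTranspose_sub, Matrix.frobenius_norm_conjTranspose]
            exact hedge _
          · rw [← Matrix.conjTranspose_sub, Matrix.frobenius_norm_conjTranspose]
            exact hedge _
      _ = 4 * rad := by ring
  have htr := abs_re_trace_le (ρ (plaquetteHolonomy U x i j) - ρ (plaquetteHolonomy U' x i j))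
  rw [Matrix.trace_sub, Complex.sub_re] at htr
  have hN : (0 : ℝ) ≤ N := Nat.cast_nonneg _
  have h3 : (N : ℝ) * ‖ρ (plaquetteHolonomy U x i j) - ρ (plaquetteHolonomy U' x i j)‖ ≤
      N * ((N : ℝ) ^ 3 * (4 * rad)) := mul_le_mul_of_nonneg_left hdiff hN
  have h4 := (abs_le.1 (htr.trans h3)).1
  have h5 : (N : ℝ) * ((N : ℝ) ^ 3 * (4 * rad)) = 4 * (N : ℝ) ^ 4 * rad := by ring
  linarith

/-- **The large-field event misses the domain.** If `ε + 4 N⁴ rad < 1` then a real configuration with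
SOME plaquette of deficit `≥ 1` is not in `smallFieldDomain ρ cb rad ε (blockCorners cb)` — there the
activity of the whole-torus polymer is unconstrained by `HasAnalyticNormLE`. -/
theorem not_mem_smallFieldDomain_of_le_deficit (hρu : ∀ g, ρ g ∈ Matrix.unitaryGroup (Fin N) ℂ)
    {cb : ℕ} {rad ε : ℝ} (hsmall : ε + 4 * (N : ℝ) ^ 4 * rad < 1) {U : GaugeConfig 4 S G}
    (hU : ∃ p : Plaquette 4 S, 1 ≤ (N : ℝ) - (ρ (plaquetteHolonomy U p.1 p.2.1.1 p.2.1.2)).trace.re) :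
    complexify ρ U ∉ smallFieldDomain ρ cb rad ε (blockCorners cb) := fun h => by
  obtain ⟨p, hp⟩ := hU
  have := deficit_le_of_mem_smallFieldDomain ρ hρu h p
  linarith

end Geometry

/-! ### 3. The adversarial format instance of the counterexample -/

section Adversary

variable {G : Type} [Group G] [MeasurableSpace G] {N S : ℕ} [NeZero S]
  (ρ : G →* Matrix (Fin N) (Fin N) ℂ)

/-- **The adversarial format instance.** For unitary `ρ`, any block size `cb`, domain parameters with
`ε + 4 N⁴ rad < 1`, any coupling `β`, any `κ`, and ANY bounded measurable gauge-invariant `a ≥ 0`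
that vanishes on the configurations all of whose plaquette deficits are `< 1` (i.e. `a` is supported
on the large-field event `L = {∃ p, deficit_p ≥ 1}`), the effective action `⟨β, bump cb a⟩` — Gibbs
weight `exp(-β S_W(U) - a(U))` by `bump_total` — satisfies the format hypothesis
`InFormat ρ (smallFieldDomain ρ cb rad ε) κ B₀ C₀` of `FormatRobustness` for all `B₀, C₀ ≥ 0`. Steps
(3)–(5) of the module docstring choose `a` (two balanced corner events inside `L`, everything else in
`L` suppressed) so that the `Φ–Φ` covariances of two such actions differ by `0.4 · K'⁸ ≫ 2δ/β²` once
the torus side `S` is large at fixed `β`. -/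
theorem adversarial_inFormat (hρu : ∀ g, ρ g ∈ Matrix.unitaryGroup (Fin N) ℂ) (cb : ℕ)
    {rad ε : ℝ} (hsmall : ε + 4 * (N : ℝ) ^ 4 * rad < 1) {a : GaugeConfig 4 S G → ℝ}
    (hgi : IsGaugeInvariant a) (hmeas : Measurable a) (hbdd : ∃ C, ∀ U, |a U| ≤ C)
    (ha : ∀ U, 0 ≤ a U)
    (haL : ∀ U : GaugeConfig 4 S G,
      (∀ p : Plaquette 4 S, (N : ℝ) - (ρ (plaquetteHolonomy U p.1 p.2.1.1 p.2.1.2)).trace.re < 1) →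
        a U = 0)
    (β κ : ℝ) {B₀ C₀ : ℝ} (hB₀ : 0 ≤ B₀) (hC₀ : 0 ≤ C₀) :
    (⟨β, bump cb a hgi hmeas hbdd⟩ : BalabanEffectiveAction 4 S G cb).InFormat ρ
      (smallFieldDomain ρ cb rad ε) κ B₀ C₀ := by
  refine bump_inFormat_of_nonneg ρ ha _ (fun U hU => haL U fun p => ?_) β κ hB₀ hC₀
  by_contra hp
  exact not_mem_smallFieldDomain_of_le_deficit ρ hρu hsmall ⟨p, not_lt.1 hp⟩ hU

/-- **The stub's side conditions are met by the adversary's parameters.** Given the prover's `P₀, β₁`,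
put `P := max P₀ 1`; for every `β ≥ max β₁ 1` the choices `ε := P/β`, `rad := √(P/β)`, `B₀ := 0`
(with `Λ = 0`) satisfy `0 < rad`, `0 < ε`, `B₀ ≤ Λ rad²`, `β₁ ≤ β`, `P₀ ≤ β ε`, `P₀ ≤ β rad²`; and
`ε + 4N⁴ rad < 1` holds for all large `β` (both `P/β` and `√(P/β)` tend to `0`). -/
theorem adversarial_sideConditions (N : ℕ) (P₀ β₁ : ℝ) :
    ∃ β₂ : ℝ, ∀ β : ℝ, β₂ ≤ β →
      let P : ℝ := max P₀ 1
      0 < Real.sqrt (P / β) ∧ 0 < P / β ∧ (0 : ℝ) ≤ 0 * Real.sqrt (P / β) ^ 2 ∧ β₁ ≤ β ∧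
        P₀ ≤ β * (P / β) ∧ P₀ ≤ β * Real.sqrt (P / β) ^ 2 ∧
        P / β + 4 * (N : ℝ) ^ 4 * Real.sqrt (P / β) < 1 := by
  set P : ℝ := max P₀ 1 with hP
  have hP1 : 1 ≤ P := le_max_right _ _
  have hP0 : 0 < P := lt_of_lt_of_le one_pos hP1
  -- `P/β → 0` and `√(P/β) → 0` as `β → ∞`
  have h1 : Tendsto (fun β : ℝ => P / β) atTop (𝓝 0) := tendsto_const_nhds.div_atTop tendsto_id
  have h2 : Tendsto (fun β : ℝ => Real.sqrt (P / β)) atTop (𝓝 0) := by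
    have := (Real.continuous_sqrt.tendsto (0 : ℝ)).comp h1
    rw [Real.sqrt_zero] at this
    exact this
  have h3 : Tendsto (fun β : ℝ => P / β + 4 * (N : ℝ) ^ 4 * Real.sqrt (P / β)) atTop (𝓝 0) := by
    simpa using h1.add (h2.const_mul (4 * (N : ℝ) ^ 4))
  have hev : ∀ᶠ β : ℝ in atTop, P / β + 4 * (N : ℝ) ^ 4 * Real.sqrt (P / β) < 1 :=
    h3.eventually (gt_mem_nhds one_pos)
  obtain ⟨β₃, hβ₃⟩ := eventually_atTop.1 hev
  refine ⟨max (max β₁ 1) β₃, fun β hβ => ?_⟩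
  have hβ1 : 1 ≤ β := (le_max_right β₁ 1).trans ((le_max_left _ _).trans hβ)
  have hβ0 : 0 < β := lt_of_lt_of_le one_pos hβ1
  have hPβ : 0 < P / β := div_pos hP0 hβ0
  have hsq : Real.sqrt (P / β) ^ 2 = P / β := Real.sq_sqrt hPβ.le
  have hmul : β * (P / β) = P := mul_div_cancel₀ P hβ0.ne'
  refine ⟨Real.sqrt_pos.2 hPβ, hPβ, by positivity, (le_max_left β₁ 1).trans ((le_max_left _ _).trans hβ),
    ?_, ?_, hβ₃ β ((le_max_right _ _).trans hβ)⟩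
  · rw [hmul]; exact le_max_left _ _
  · rw [hsq, hmul]; exact le_max_left _ _

end Adversary

end FormatLoophole

end Summit.QuantumFields.YangMills.Cruxes.TunedSequenceExists.TransportToFixedDistance
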